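import Literature.Analysis.Calculus.LogScaleCutoff
import HarnessLib

/-!
# Energy of cut-off Cauchy data: the near/far part and the compact part

Analysis/Calculus support file (everything proved, no definitions). For a continuous potential
`V ≥ 0`, data `h ∈ C¹`, `g` continuous, and a `C¹` cutoff `χ` with values in `[0, 1]`, the data
energy density `e(h, g) = g² + h′² + V h²` of the cut data satisfies pointwise

* `e(χh, χg) ≤ 2 e(h, g) + 2 (χ′h)²` (`cutData_density_le`),
* `e((1−χ)h, (1−χ)g) ≤ (1+η) e(h, g) + (1+η⁻¹) (χ′h)²` for `η > 0` (`tailData_density_le`),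

and for the logarithmic-scale cutoffs of `LogScaleCutoff.exists_logScaleCutoff`
(`|χ′(x)| ≤ C/(Λ|x|)`, `Λ = log(R₁/R₀)`) and data vanishing on `[−ρ, ρ]` the layer cost is
controlled by the two-sided Hardy bound: `∫⁻ (χ′h)² ≤ 4(C/Λ)² ∫⁻ h′²` (`lintegral_cutoffCost_le`).
Consequently (`lintegral_cutData_le`, `lintegral_tailData_le`)

  `∫⁻ e(χh, χg) ≤ (2 + 8C²/Λ²) ∫⁻ e(h,g)`,  `∫⁻ e((1−χ)h, (1−χ)g) ≤ (1 + η + (1+η⁻¹)·4C²/Λ²) ∫⁻ e(h,g)`,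

with lower Lebesgue integrals over `ℝ` (`∞` allowed). This is the energy bookkeeping of the
large-scale splitting of finite-energy data supported off a shell (route PhotonSphereChannels, crux
`WindowedShellChannels`, stmt-FinalStateConjecture-14085, stub `stub_dyadicSplit`). Folklore.
-/

noncomputable section

namespace Literature.Analysis.Calculus

open Set Filter Topology MeasureTheory Real
open scoped ENNReal

variable {V h g χ : ℝ → ℝ}

/-- Young's inequality `(a + b)² ≤ (1+η)a² + (1+η⁻¹)b²`. [folklore] -/
theorem add_sq_le_weighted {η : ℝ} (hη : 0 < η) (a b : ℝ) :
    (a + b) ^ 2 ≤ (1 + η) * a ^ 2 + (1 + η⁻¹) * b ^ 2 := by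
  have h1 : 2 * a * b ≤ η * a ^ 2 + η⁻¹ * b ^ 2 := by
    have hη0 : η ≠ 0 := hη.ne'
    have h2 : 0 ≤ (η * a - b) ^ 2 / η := by positivity
    have e : (η * a - b) ^ 2 / η = η * a ^ 2 + η⁻¹ * b ^ 2 - 2 * a * b := by
      field_simp
      ring
    linarith [e ▸ h2]
  nlinarith

/-- **Density of the compact part**: `e(χh, χg) ≤ 2e(h,g) + 2(χ′h)²` for `0 ≤ χ ≤ 1`, `V ≥ 0`.
[folklore] -/
theorem cutData_density_le (hV0 : ∀ x, 0 ≤ V x) (hh : Differentiable ℝ h) (hχ : Differentiable ℝ χ)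
    (hχ01 : ∀ x, 0 ≤ χ x ∧ χ x ≤ 1) (x : ℝ) :
    (χ x * g x) ^ 2 + deriv (fun y => χ y * h y) x ^ 2 + V x * (χ x * h x) ^ 2
      ≤ 2 * (g x ^ 2 + deriv h x ^ 2 + V x * h x ^ 2) + 2 * (deriv χ x * h x) ^ 2 := by
  rw [deriv_fun_mul (hχ x) (hh x)]
  obtain ⟨h0, h1⟩ := hχ01 x
  have hχ2 : χ x ^ 2 ≤ 1 := by nlinarith
  have hVx := hV0 x
  have e1 : (χ x * g x) ^ 2 ≤ g x ^ 2 := by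
    rw [mul_pow]; nlinarith [sq_nonneg (g x)]
  have e2 : (deriv χ x * h x + χ x * deriv h x) ^ 2
      ≤ 2 * (deriv χ x * h x) ^ 2 + 2 * deriv h x ^ 2 := by
    have : (χ x * deriv h x) ^ 2 ≤ deriv h x ^ 2 := by
      rw [mul_pow]; nlinarith [sq_nonneg (deriv h x)]
    nlinarith [sq_nonneg (deriv χ x * h x - χ x * deriv h x)]
  have e3 : V x * (χ x * h x) ^ 2 ≤ V x * h x ^ 2 := by
    rw [mul_pow]
    exact mul_le_mul_of_nonneg_left (by nlinarith [sq_nonneg (h x)]) hVx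
  nlinarith [sq_nonneg (g x), sq_nonneg (deriv h x), mul_nonneg hVx (sq_nonneg (h x))]

/-- **Density of the near/far part**: `e((1−χ)h, (1−χ)g) ≤ (1+η)e(h,g) + (1+η⁻¹)(χ′h)²` for
`0 ≤ χ ≤ 1`, `V ≥ 0`, `η > 0`. [folklore] -/
theorem tailData_density_le (hV0 : ∀ x, 0 ≤ V x) (hh : Differentiable ℝ h) (hχ : Differentiable ℝ χ)
    (hχ01 : ∀ x, 0 ≤ χ x ∧ χ x ≤ 1) {η : ℝ} (hη : 0 < η) (x : ℝ) :
    ((1 - χ x) * g x) ^ 2 + deriv (fun y => (1 - χ y) * h y) x ^ 2 + V x * ((1 - χ x) * h x) ^ 2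
      ≤ (1 + η) * (g x ^ 2 + deriv h x ^ 2 + V x * h x ^ 2) + (1 + η⁻¹) * (deriv χ x * h x) ^ 2 := by
  have hd1 : DifferentiableAt ℝ (fun y => 1 - χ y) x := (hχ x).const_sub 1
  rw [deriv_fun_mul hd1 (hh x), deriv_const_sub]
  obtain ⟨h0, h1⟩ := hχ01 x
  have hm2 : (1 - χ x) ^ 2 ≤ 1 := by nlinarith
  have hVx := hV0 x
  have hη1 : 0 ≤ η := hη.le
  have hη2 : 0 ≤ η⁻¹ := inv_nonneg.2 hη1
  have e1 : ((1 - χ x) * g x) ^ 2 ≤ g x ^ 2 := by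
    rw [mul_pow]; nlinarith [sq_nonneg (g x)]
  have e2 : (-deriv χ x * h x + (1 - χ x) * deriv h x) ^ 2
      ≤ (1 + η) * deriv h x ^ 2 + (1 + η⁻¹) * (deriv χ x * h x) ^ 2 := by
    have hy := add_sq_le_weighted hη ((1 - χ x) * deriv h x) (-deriv χ x * h x)
    have : ((1 - χ x) * deriv h x) ^ 2 ≤ deriv h x ^ 2 := by
      rw [mul_pow]; nlinarith [sq_nonneg (deriv h x)]
    have hneg : (-deriv χ x * h x) ^ 2 = (deriv χ x * h x) ^ 2 := by ring
    rw [add_comm]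
    rw [hneg] at hy
    nlinarith
  have e3 : V x * ((1 - χ x) * h x) ^ 2 ≤ V x * h x ^ 2 := by
    rw [mul_pow]
    exact mul_le_mul_of_nonneg_left (by nlinarith [sq_nonneg (h x)]) hVx
  nlinarith [sq_nonneg (g x), sq_nonneg (deriv h x), mul_nonneg hVx (sq_nonneg (h x)),
    mul_nonneg hη1 (sq_nonneg (g x)), mul_nonneg hη1 (mul_nonneg hVx (sq_nonneg (h x)))]

/-- **The layer cost of a logarithmic-scale cutoff** against data vanishing on `[−ρ, ρ]`:
`∫⁻ (χ′h)² ≤ 4(C/Λ)² ∫⁻ h′²`. [folklore] -/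
theorem lintegral_cutoffCost_le (hh : ContDiff ℝ 1 h) {ρ C Λ : ℝ} (hρ : 0 < ρ)
    (hΛ : 0 < Λ) (h0 : ∀ x, |x| ≤ ρ → h x = 0)
    (hχ' : ∀ x, x ≠ 0 → |deriv χ x| ≤ C / (Λ * |x|)) :
    ∫⁻ x, ENNReal.ofReal ((deriv χ x * h x) ^ 2)
      ≤ ENNReal.ofReal (4 * (C / Λ) ^ 2) * ∫⁻ x, ENNReal.ofReal (deriv h x ^ 2) := by
  have hpt : ∀ x, (deriv χ x * h x) ^ 2 ≤ (C / Λ) ^ 2 * (h x ^ 2 / x ^ 2) := by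
    intro x
    by_cases hx : |x| ≤ ρ
    · rw [h0 x hx]; simp
    · have hx0 : x ≠ 0 := by
        intro h; apply hx; rw [h, abs_zero]; exact hρ.le
      have hax : 0 < |x| := abs_pos.2 hx0
      have h1 := hχ' x hx0
      have h2 : (deriv χ x) ^ 2 ≤ (C / (Λ * |x|)) ^ 2 := by
        rw [← sq_abs (deriv χ x)]
        exact pow_le_pow_left₀ (abs_nonneg _) h1 2
      calc (deriv χ x * h x) ^ 2 = deriv χ x ^ 2 * h x ^ 2 := by ring
        _ ≤ (C / (Λ * |x|)) ^ 2 * h x ^ 2 := mul_le_mul_of_nonneg_right h2 (sq_nonneg _)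
        _ = (C / Λ) ^ 2 * (h x ^ 2 / x ^ 2) := by
            rw [← sq_abs x]
            field_simp
  calc ∫⁻ x, ENNReal.ofReal ((deriv χ x * h x) ^ 2)
      ≤ ∫⁻ x, ENNReal.ofReal ((C / Λ) ^ 2) * ENNReal.ofReal (h x ^ 2 / x ^ 2) := by
        refine lintegral_mono fun x => ?_
        rw [← ENNReal.ofReal_mul (sq_nonneg _)]
        exact ENNReal.ofReal_le_ofReal (hpt x)
    _ = ENNReal.ofReal ((C / Λ) ^ 2) * ∫⁻ x, ENNReal.ofReal (h x ^ 2 / x ^ 2) := by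
        rw [lintegral_const_mul' _ _ ENNReal.ofReal_ne_top]
    _ ≤ ENNReal.ofReal ((C / Λ) ^ 2) * (4 * ∫⁻ x, ENNReal.ofReal (deriv h x ^ 2)) := by
        gcongr
        exact lintegral_sq_div_sq_le_four_mul hh hρ h0
    _ = ENNReal.ofReal (4 * (C / Λ) ^ 2) * ∫⁻ x, ENNReal.ofReal (deriv h x ^ 2) := by
        rw [← mul_assoc, show (4 : ℝ≥0∞) = ENNReal.ofReal 4 by simp, ← ENNReal.ofReal_mul (sq_nonneg _)]
        congr 1; rw [mul_comm]

section Integrated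

variable (hV : Continuous V) (hV0 : ∀ x, 0 ≤ V x) (hh : ContDiff ℝ 1 h) (hg : Continuous g)
  (hχ : ContDiff ℝ 1 χ) (hχ01 : ∀ x, 0 ≤ χ x ∧ χ x ≤ 1)
  {ρ C Λ : ℝ} (hρ : 0 < ρ) (hΛ : 0 < Λ) (h0 : ∀ x, |x| ≤ ρ → h x = 0)
  (hχ' : ∀ x, x ≠ 0 → |deriv χ x| ≤ C / (Λ * |x|))
include hV hV0 hh hg hχ hχ01 hρ hΛ h0 hχ'

/-- **Energy of the compact part**: `∫⁻ e(χh, χg) ≤ (2 + 8C²/Λ²) ∫⁻ e(h,g)`. [folklore] -/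
theorem lintegral_cutData_le :
    ∫⁻ x, ENNReal.ofReal ((χ x * g x) ^ 2 + deriv (fun y => χ y * h y) x ^ 2 + V x * (χ x * h x) ^ 2)
      ≤ ENNReal.ofReal (2 + 8 * (C / Λ) ^ 2)
        * ∫⁻ x, ENNReal.ofReal (g x ^ 2 + deriv h x ^ 2 + V x * h x ^ 2) := by
  have hhd : Differentiable ℝ h := hh.differentiable (by norm_num)
  have hχd : Differentiable ℝ χ := hχ.differentiable (by norm_num)
  have hmeas : Measurable fun x => ENNReal.ofReal (g x ^ 2 + deriv h x ^ 2 + V x * h x ^ 2) :=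
    (((hg.pow 2).add ((hh.continuous_deriv le_rfl).pow 2)).add
      (hV.mul (hh.continuous.pow 2))).measurable.ennreal_ofReal
  have hcost := lintegral_cutoffCost_le hh hρ hΛ h0 hχ'
  calc ∫⁻ x, ENNReal.ofReal ((χ x * g x) ^ 2 + deriv (fun y => χ y * h y) x ^ 2 + V x * (χ x * h x) ^ 2)
      ≤ ∫⁻ x, (2 * ENNReal.ofReal (g x ^ 2 + deriv h x ^ 2 + V x * h x ^ 2)
          + 2 * ENNReal.ofReal ((deriv χ x * h x) ^ 2)) := by
        refine lintegral_mono fun x => ?_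
        have e2 : (2 : ℝ≥0∞) = ENNReal.ofReal 2 := by simp
        rw [e2, ← ENNReal.ofReal_mul (by norm_num), ← ENNReal.ofReal_mul (by norm_num),
          ← ENNReal.ofReal_add (by have := hV0 x; positivity) (by positivity)]
        exact ENNReal.ofReal_le_ofReal (cutData_density_le hV0 hhd hχd hχ01 x)
    _ = 2 * (∫⁻ x, ENNReal.ofReal (g x ^ 2 + deriv h x ^ 2 + V x * h x ^ 2))
          + 2 * ∫⁻ x, ENNReal.ofReal ((deriv χ x * h x) ^ 2) := by
        rw [lintegral_add_left (hmeas.const_mul 2), lintegral_const_mul _ hmeas,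
          lintegral_const_mul' _ _ (by simp)]
    _ ≤ 2 * (∫⁻ x, ENNReal.ofReal (g x ^ 2 + deriv h x ^ 2 + V x * h x ^ 2))
          + 2 * (ENNReal.ofReal (4 * (C / Λ) ^ 2) * ∫⁻ x, ENNReal.ofReal (deriv h x ^ 2)) := by
        gcongr
    _ ≤ 2 * (∫⁻ x, ENNReal.ofReal (g x ^ 2 + deriv h x ^ 2 + V x * h x ^ 2))
          + 2 * (ENNReal.ofReal (4 * (C / Λ) ^ 2)
            * ∫⁻ x, ENNReal.ofReal (g x ^ 2 + deriv h x ^ 2 + V x * h x ^ 2)) := by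
        gcongr with x
        have := hV0 x
        nlinarith [sq_nonneg (g x), mul_nonneg this (sq_nonneg (h x))]
    _ = ENNReal.ofReal (2 + 8 * (C / Λ) ^ 2)
          * ∫⁻ x, ENNReal.ofReal (g x ^ 2 + deriv h x ^ 2 + V x * h x ^ 2) := by
        rw [← mul_assoc, ← add_mul]
        congr 1
        rw [show (2 : ℝ≥0∞) = ENNReal.ofReal 2 by simp, ← ENNReal.ofReal_mul (by norm_num),
          ← ENNReal.ofReal_add (by norm_num) (by positivity)]
        congr 1; ring

/-- **Energy of the near/far part**: `∫⁻ e((1−χ)h, (1−χ)g) ≤ (1 + η + (1+η⁻¹)·4C²/Λ²) ∫⁻ e(h,g)`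
for `η > 0`. [folklore] -/
theorem lintegral_tailData_le {η : ℝ} (hη : 0 < η) :
    ∫⁻ x, ENNReal.ofReal (((1 - χ x) * g x) ^ 2 + deriv (fun y => (1 - χ y) * h y) x ^ 2
        + V x * ((1 - χ x) * h x) ^ 2)
      ≤ ENNReal.ofReal (1 + η + (1 + η⁻¹) * (4 * (C / Λ) ^ 2))
        * ∫⁻ x, ENNReal.ofReal (g x ^ 2 + deriv h x ^ 2 + V x * h x ^ 2) := by
  have hhd : Differentiable ℝ h := hh.differentiable (by norm_num)
  have hχd : Differentiable ℝ χ := hχ.differentiable (by norm_num)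
  have hη1 : 0 ≤ 1 + η := by linarith
  have hη2 : 0 ≤ 1 + η⁻¹ := by have := inv_nonneg.2 hη.le; linarith
  have hmeas : Measurable fun x => ENNReal.ofReal (g x ^ 2 + deriv h x ^ 2 + V x * h x ^ 2) :=
    (((hg.pow 2).add ((hh.continuous_deriv le_rfl).pow 2)).add
      (hV.mul (hh.continuous.pow 2))).measurable.ennreal_ofReal
  have hcost := lintegral_cutoffCost_le hh hρ hΛ h0 hχ'
  calc ∫⁻ x, ENNReal.ofReal (((1 - χ x) * g x) ^ 2 + deriv (fun y => (1 - χ y) * h y) x ^ 2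
        + V x * ((1 - χ x) * h x) ^ 2)
      ≤ ∫⁻ x, (ENNReal.ofReal (1 + η) * ENNReal.ofReal (g x ^ 2 + deriv h x ^ 2 + V x * h x ^ 2)
          + ENNReal.ofReal (1 + η⁻¹) * ENNReal.ofReal ((deriv χ x * h x) ^ 2)) := by
        refine lintegral_mono fun x => ?_
        rw [← ENNReal.ofReal_mul hη1, ← ENNReal.ofReal_mul hη2,
          ← ENNReal.ofReal_add (by have := hV0 x; positivity) (by positivity)]
        exact ENNReal.ofReal_le_ofReal (tailData_density_le hV0 hhd hχd hχ01 hη x)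
    _ = ENNReal.ofReal (1 + η) * (∫⁻ x, ENNReal.ofReal (g x ^ 2 + deriv h x ^ 2 + V x * h x ^ 2))
          + ENNReal.ofReal (1 + η⁻¹) * ∫⁻ x, ENNReal.ofReal ((deriv χ x * h x) ^ 2) := by
        rw [lintegral_add_left (hmeas.const_mul _), lintegral_const_mul _ hmeas,
          lintegral_const_mul' _ _ ENNReal.ofReal_ne_top]
    _ ≤ ENNReal.ofReal (1 + η) * (∫⁻ x, ENNReal.ofReal (g x ^ 2 + deriv h x ^ 2 + V x * h x ^ 2))
          + ENNReal.ofReal (1 + η⁻¹) * (ENNReal.ofReal (4 * (C / Λ) ^ 2)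
            * ∫⁻ x, ENNReal.ofReal (deriv h x ^ 2)) := by
        gcongr
    _ ≤ ENNReal.ofReal (1 + η) * (∫⁻ x, ENNReal.ofReal (g x ^ 2 + deriv h x ^ 2 + V x * h x ^ 2))
          + ENNReal.ofReal (1 + η⁻¹) * (ENNReal.ofReal (4 * (C / Λ) ^ 2)
            * ∫⁻ x, ENNReal.ofReal (g x ^ 2 + deriv h x ^ 2 + V x * h x ^ 2)) := by
        gcongr with x
        have := hV0 x
        nlinarith [sq_nonneg (g x), mul_nonneg this (sq_nonneg (h x))]
    _ = ENNReal.ofReal (1 + η + (1 + η⁻¹) * (4 * (C / Λ) ^ 2))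
          * ∫⁻ x, ENNReal.ofReal (g x ^ 2 + deriv h x ^ 2 + V x * h x ^ 2) := by
        rw [← mul_assoc, ← add_mul]
        congr 1
        rw [← ENNReal.ofReal_mul hη2, ← ENNReal.ofReal_add hη1 (by positivity)]

end Integrated

end Literature.Analysis.Calculus
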